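import Literature.Geometry.DiscreteGeometry.TwoShellPatterns
import Literature.MathematicalPhysics.StatisticalMechanics.LennardJonesClusters

/-!
# Route `PhononSlackCertificates`, crux `FarFieldGapR` (stmt-AtomisticToContinuum-14969), line `Sketch`:
the poisoning step, part 1 — invisibility of a poisoned particle

ONE POISONING STEP of the octahedral-poisoning collapse `AllBadGap → FarFieldGapR`: in a
`δ`-separated configuration `y` (`0 < δ ≤ 3/5`) with a `1/20`-good particle `i` (witness
`(a, A, P, f)`: the `3a/2`-neighbourhood of `y i` is an `a/20`-match of the rotated, scaled fcc/hcp
two-shell pattern `y i + a • A P`), the particle inserted at the octahedral hole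
`z := y i + a • A h`, `h = e₀/√2`, of the matched frame

1. keeps `δ`-separation (every particle is `≥ a (1/√2 - 1/20) ≥ 0.6176 > 3/5` from `z`);
2. is POISONED — the six octahedron vertices `z ± (a/√2) A eₘ` carry particles within `a/20` —
   and a poisoned particle is INVISIBLE to every goodness witness (`step_invisible`: no witness
   assigns it, no witness has it within its covering radius), so it is bad, creates no good
   particle, and makes `i` bad: the number of good particles drops;
3. costs at most `K(δ) = (2/δ + 1)³ · V_LJ(3/5)` in energy.

This file: the numerical constants, the signed-axis selection lemma, the pattern facts in the form
used, and the invisibility theorem `step_invisible`; the step itself (`stub_step`) is the companion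
file `PhononSlackCertificatesFarFieldGapRStep.lean`.  Finite Euclidean geometry, explicit margins.
-/

noncomputable section

open scoped BigOperators Classical

namespace Summit.AtomisticToContinuum.Crystallization.Theorems.PhononSlackCertificatesFarFieldGapR

open Literature.MathematicalPhysics.StatisticalMechanics Literature.Geometry.DiscreteGeometry



/-! ## Numerical constants -/

/-- `1.41421 ≤ √2 ≤ 1.41422`. -/
theorem step_sqrt_two_bounds : (1.41421 : ℝ) ≤ Real.sqrt 2 ∧ Real.sqrt 2 ≤ 1.41422 := by
  constructor
  · rw [Real.le_sqrt (by norm_num) (by norm_num)]; norm_num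
  · rw [Real.sqrt_le_left (by norm_num)]; norm_num

/-- `0.7071 ≤ 1/√2 ≤ 0.70711`. -/
theorem step_inv_sqrt_two_bounds :
    (0.7071 : ℝ) ≤ (Real.sqrt 2)⁻¹ ∧ (Real.sqrt 2)⁻¹ ≤ 0.70711 := by
  obtain ⟨h1, h2⟩ := step_sqrt_two_bounds
  have hpos : (0 : ℝ) < Real.sqrt 2 := by positivity
  constructor
  · rw [le_inv_comm₀ (by norm_num) hpos]
    exact h2.trans (by norm_num)
  · rw [inv_le_comm₀ hpos (by norm_num)]
    exact le_trans (by norm_num) h1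

/-- `(1/√2)² = 1/2`. -/
private theorem step_inv_sqrt_two_sq : ((Real.sqrt 2)⁻¹) ^ 2 = (1 / 2 : ℝ) := by
  rw [inv_pow, Real.sq_sqrt (by norm_num : (0 : ℝ) ≤ 2)]
  norm_num

/-- `0.5773 ≤ 1/√3`. -/
private theorem step_inv_sqrt_three_bound : (0.5773 : ℝ) ≤ (Real.sqrt 3)⁻¹ := by
  have h : Real.sqrt 3 ≤ 1.73206 := by
    rw [Real.sqrt_le_left (by norm_num)]; norm_num
  have hpos : (0 : ℝ) < Real.sqrt 3 := by positivity
  rw [le_inv_comm₀ (by norm_num) hpos]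
  exact h.trans (by norm_num)

/-! ## A signed coordinate axis aligned with a given vector -/

/-- For every linear isometry `A` of `ℝ³` and every `w` there is a signed coordinate axis
`σ • eₘ` whose image under `A` makes an angle `≤ arccos (1/√3)` with `w`:
`‖w‖ ≤ √3 · σ ⟪A eₘ, w⟫`. -/
private theorem step_exists_axis (A : (EuclideanSpace ℝ (Fin 3)) →ₗᵢ[ℝ] (EuclideanSpace ℝ (Fin 3))) (w : (EuclideanSpace ℝ (Fin 3))) :
    ∃ (m : Fin 3) (σ : ℝ), (σ = 1 ∨ σ = -1) ∧
      ‖w‖ ≤ Real.sqrt 3 * (σ * inner ℝ (A (EuclideanSpace.single m (1 : ℝ))) w) := by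
  -- pull `w` back through `A` (surjective in finite dimension)
  set B := A.toLinearIsometryEquiv rfl with hB
  set w' : (EuclideanSpace ℝ (Fin 3)) := B.symm w with hw'
  have hAw' : A w' = w := by
    rw [← LinearIsometry.toLinearIsometryEquiv_apply A rfl, hw', LinearIsometryEquiv.apply_symm_apply]
  have hinner : ∀ m : Fin 3, inner ℝ (A (EuclideanSpace.single m (1 : ℝ))) w = w' m := by
    intro m
    rw [← hAw', LinearIsometry.inner_map_map, EuclideanSpace.inner_single_left]
    simp
  have hnorm : ‖w‖ = ‖w'‖ := by rw [← hAw', A.norm_map]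
  -- the largest coordinate of `w'` in absolute value
  obtain ⟨m, -, hm⟩ := Finset.exists_max_image Finset.univ (fun m : Fin 3 => |w' m|)
    Finset.univ_nonempty
  have hsq : ‖w'‖ ^ 2 ≤ 3 * |w' m| ^ 2 := by
    rw [EuclideanSpace.norm_sq_eq, Fin.sum_univ_three]
    simp only [Real.norm_eq_abs]
    have h0 := hm 0 (Finset.mem_univ _)
    have h1 := hm 1 (Finset.mem_univ _)
    have h2 := hm 2 (Finset.mem_univ _)
    nlinarith [abs_nonneg (w' 0), abs_nonneg (w' 1), abs_nonneg (w' 2),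
      mul_le_mul h0 h0 (abs_nonneg _) (abs_nonneg _),
      mul_le_mul h1 h1 (abs_nonneg _) (abs_nonneg _),
      mul_le_mul h2 h2 (abs_nonneg _) (abs_nonneg _)]
  have hle : ‖w'‖ ≤ Real.sqrt 3 * |w' m| := by
    have h3 : (0 : ℝ) ≤ Real.sqrt 3 * |w' m| := by positivity
    rw [← pow_le_pow_iff_left₀ (norm_nonneg _) h3 two_ne_zero]
    calc ‖w'‖ ^ 2 ≤ 3 * |w' m| ^ 2 := hsq
      _ = (Real.sqrt 3 * |w' m|) ^ 2 := by
          rw [mul_pow, Real.sq_sqrt (by norm_num : (0 : ℝ) ≤ 3)]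
  by_cases hsign : 0 ≤ w' m
  · refine ⟨m, 1, Or.inl rfl, ?_⟩
    rw [hinner m, one_mul, hnorm, ← abs_of_nonneg hsign]
    exact hle
  · refine ⟨m, -1, Or.inr rfl, ?_⟩
    rw [hinner m, hnorm]
    have : (-1 : ℝ) * w' m = |w' m| := by
      rw [abs_of_neg (not_le.1 hsign)]; ring
    rw [this]
    exact hle

/-! ## Pattern facts in the form used here -/

/-- Points of either two-shell pattern have norm in `[1, √2]`. -/
private theorem step_norm_mem {P : Finset (EuclideanSpace ℝ (Fin 3))} (hP : P = fccTwoShellPattern ∨ P = hcpTwoShellPattern)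
    {v : (EuclideanSpace ℝ (Fin 3))} (hv : v ∈ P) : 1 ≤ ‖v‖ ∧ ‖v‖ ≤ Real.sqrt 2 := by
  have h1 : (1 : ℝ) ≤ Real.sqrt 2 := Real.one_le_sqrt.mpr (by norm_num)
  have h : ‖v‖ = 1 ∨ ‖v‖ = Real.sqrt 2 := by
    rcases hP with rfl | rfl
    · exact norm_of_mem_fccTwoShellPattern hv
    · exact norm_of_mem_hcpTwoShellPattern hv
  rcases h with h | h <;> rw [h]
  · exact ⟨le_rfl, h1⟩
  · exact ⟨h1, le_rfl⟩

/-- Either two-shell pattern is `1`-separated. -/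
private theorem step_one_le_dist_mem {P : Finset (EuclideanSpace ℝ (Fin 3))}
    (hP : P = fccTwoShellPattern ∨ P = hcpTwoShellPattern) {v w : (EuclideanSpace ℝ (Fin 3))} (hv : v ∈ P) (hw : w ∈ P)
    (hne : v ≠ w) : 1 ≤ dist v w := by
  rcases hP with rfl | rfl
  · exact one_le_dist_of_mem_fccTwoShellPattern hv hw hne
  · exact one_le_dist_of_mem_hcpTwoShellPattern hv hw hne

/-- A point matched within `a/20` to the pattern site `q + a • A v` is at distance
`∈ [19a/20, (√2 + 1/20) a]` from the centre `q`. -/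
private theorem step_matched_dist {P : Finset (EuclideanSpace ℝ (Fin 3))}
    (hP : P = fccTwoShellPattern ∨ P = hcpTwoShellPattern) {a : ℝ} (ha0 : 0 ≤ a)
    (A : (EuclideanSpace ℝ (Fin 3)) →ₗᵢ[ℝ] (EuclideanSpace ℝ (Fin 3))) {v : (EuclideanSpace ℝ (Fin 3))} (hv : v ∈ P) {p q : (EuclideanSpace ℝ (Fin 3))}
    (h : dist p (q + a • A v) ≤ 1 / 20 * a) :
    19 / 20 * a ≤ dist p q ∧ dist p q ≤ (Real.sqrt 2 + 1 / 20) * a := by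
  obtain ⟨hn1, hn2⟩ := step_norm_mem hP hv
  have hd : dist (q + a • A v) q = a * ‖v‖ := by
    rw [dist_eq_norm, add_sub_cancel_left, norm_smul, Real.norm_of_nonneg ha0, A.norm_map]
  have h1 := dist_triangle p (q + a • A v) q
  have h2 := dist_triangle (q + a • A v) p q
  rw [dist_comm (q + a • A v) p] at h2
  rw [hd] at h1 h2
  constructor
  · nlinarith [mul_le_mul_of_nonneg_left hn1 ha0]
  · nlinarith [mul_le_mul_of_nonneg_left hn2 ha0]

/-- Two points matched within `a/20` to DISTINCT pattern sites of the same frame are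
`≥ 9a/10` apart. -/
private theorem step_matched_sep {P : Finset (EuclideanSpace ℝ (Fin 3))}
    (hP : P = fccTwoShellPattern ∨ P = hcpTwoShellPattern) {a : ℝ} (ha0 : 0 ≤ a)
    (A : (EuclideanSpace ℝ (Fin 3)) →ₗᵢ[ℝ] (EuclideanSpace ℝ (Fin 3))) {v w : (EuclideanSpace ℝ (Fin 3))} (hv : v ∈ P) (hw : w ∈ P) (hne : v ≠ w) {p p' q : (EuclideanSpace ℝ (Fin 3))}
    (h : dist p (q + a • A v) ≤ 1 / 20 * a) (h' : dist p' (q + a • A w) ≤ 1 / 20 * a) :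
    9 / 10 * a ≤ dist p p' := by
  have hvw : dist (q + a • A v) (q + a • A w) = a * dist v w := by
    rw [dist_eq_norm, add_sub_add_left_eq_sub, ← smul_sub, norm_smul, Real.norm_of_nonneg ha0,
      ← map_sub, A.norm_map, dist_eq_norm]
  have h1 := step_one_le_dist_mem hP hv hw hne
  have h4 := dist_triangle4 (q + a • A v) p p' (q + a • A w)
  rw [hvw, dist_comm (q + a • A v) p] at h4
  nlinarith [mul_le_mul_of_nonneg_left h1 ha0]

/-! ## Invisibility of a poisoned particle -/

/-- The alignment inequality behind invisibility: with `d = |x k - x l| ∈ [19a'/20, 1.46422 a']`,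
`s = 1/√2 ≥ 0.7071` and `t = σ⟪A eₘ, x k - x l⟫ ≥ 0.5773 d`, the squared distance
`d² - 2 a s t + a²/2` from `x k` to the aligned octahedron vertex is `≤ (3a'/2 - a/20)²`. -/
private theorem step_alignment_ineq {a a' d s t : ℝ} (ha1 : 47 / 50 ≤ a) (ha2 : a ≤ 1)
    (ha1' : 47 / 50 ≤ a') (hdlo : 19 / 20 * a' ≤ d) (hdhi : d ≤ 1.46422 * a')
    (hs : 0.7071 ≤ s) (ht : 0.5773 * d ≤ t) :
    d ^ 2 - 2 * (a * s) * t + a ^ 2 / 2 ≤ (3 / 2 * a' - a / 20) ^ 2 := by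
  have ha0 : 0 ≤ a := by linarith
  have ha0' : 0 ≤ a' := by linarith
  have hd0 : 0 ≤ d := by linarith
  have h1 : 0.7071 * (0.5773 * d) ≤ s * t := mul_le_mul hs ht (by positivity) (by linarith)
  have h2 : a * (0.7071 * (0.5773 * d)) ≤ a * (s * t) := mul_le_mul_of_nonneg_left h1 ha0
  have F1 : d * d ≤ d * (1.46422 * a') := mul_le_mul_of_nonneg_left hdhi hd0
  have F2 : d * (1.46422 * a') ≤ (1.46422 * a') * (1.46422 * a') :=
    mul_le_mul_of_nonneg_right hdhi (by positivity)
  have F3 : a * (19 / 20 * a') ≤ a * d := mul_le_mul_of_nonneg_left hdlo ha0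
  have F4 : a * (47 / 50) ≤ a * a' := mul_le_mul_of_nonneg_left ha1' ha0
  have F5 : a * a ≤ a * 1 := mul_le_mul_of_nonneg_left ha2 ha0
  nlinarith [h2, F1, F2, F3, F4, F5]

/-- **A poisoned particle is invisible to every goodness witness.**  Suppose the particle `l`
is POISONED at scale `a ∈ [47/50, 1]` in the frame `A`: each of the six octahedron vertices
`x l ± (a/√2) A eₘ` has a particle within `a/20`.  Then for every particle `k` and every
`1/20`-goodness witness `(a', A', P', f')` of `k` (scale `a' ∈ [47/50, 1]`), no pattern site is
assigned to `l` and `x l` lies strictly outside the covering radius `3a'/2` of `x k`. -/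
theorem step_invisible {N : ℕ} (x : Fin N → (EuclideanSpace ℝ (Fin 3))) (l : Fin N) {a : ℝ} (ha1 : 47 / 50 ≤ a)
    (ha2 : a ≤ 1) (A : (EuclideanSpace ℝ (Fin 3)) →ₗᵢ[ℝ] (EuclideanSpace ℝ (Fin 3)))
    (hpo : ∀ (m : Fin 3) (σ : ℝ), (σ = 1 ∨ σ = -1) →
      ∃ j, dist (x j) (x l + (a * ((Real.sqrt 2)⁻¹ * σ)) • A (EuclideanSpace.single m (1 : ℝ))) ≤
        a / 20)
    (k : Fin N) {a' : ℝ} (ha1' : 47 / 50 ≤ a') (A' : (EuclideanSpace ℝ (Fin 3)) →ₗᵢ[ℝ] (EuclideanSpace ℝ (Fin 3)))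
    (P' : Finset (EuclideanSpace ℝ (Fin 3))) (f' : (EuclideanSpace ℝ (Fin 3)) → Fin N) (hP' : P' = fccTwoShellPattern ∨ P' = hcpTwoShellPattern)
    (hf' : ∀ v ∈ P', f' v ≠ k ∧ dist (x (f' v)) (x k + a' • A' v) ≤ 1 / 20 * a')
    (hcov' : ∀ j : Fin N, j ≠ k → dist (x j) (x k) ≤ 3 / 2 * a' → ∃ v ∈ P', f' v = j) :
    (∀ v ∈ P', f' v ≠ l) ∧ 3 / 2 * a' < dist (x l) (x k) := by
  obtain ⟨hs2l, hs2u⟩ := step_inv_sqrt_two_bounds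
  have hs3 := step_inv_sqrt_three_bound
  have hsq2u := step_sqrt_two_bounds.2
  have ha0 : 0 ≤ a := by linarith
  have ha0' : 0 ≤ a' := by linarith
  have hs0 : 0 ≤ (Real.sqrt 2)⁻¹ := le_trans (by norm_num) hs2l
  -- `a/√2 ≤ 0.70711` and `a/√2 ≥ 0.664`
  have has : a * (Real.sqrt 2)⁻¹ ≤ 0.70711 := le_trans (mul_le_of_le_one_left hs0 ha2) hs2u
  have hal : 47 / 50 * 0.7071 ≤ a * (Real.sqrt 2)⁻¹ := mul_le_mul ha1 hs2l (by norm_num) ha0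
  have hone : ∀ m : Fin 3, ‖(EuclideanSpace.single m (1 : ℝ) : (EuclideanSpace ℝ (Fin 3)))‖ = 1 := fun m => by simp
  -- the vertex particles are close to `x l` and different from `l`
  have hvert : ∀ (m : Fin 3) (σ : ℝ), (σ = 1 ∨ σ = -1) → ∀ j,
      dist (x j) (x l + (a * ((Real.sqrt 2)⁻¹ * σ)) • A (EuclideanSpace.single m (1 : ℝ))) ≤
        a / 20 →
      dist (x j) (x l) ≤ a * (Real.sqrt 2)⁻¹ + a / 20 ∧ j ≠ l := by
    intro m σ hσ j hj
    have hσ1 : |σ| = 1 := by rcases hσ with rfl | rfl <;> simp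
    have hpl : dist (x l + (a * ((Real.sqrt 2)⁻¹ * σ)) • A (EuclideanSpace.single m (1 : ℝ)))
        (x l) = a * (Real.sqrt 2)⁻¹ := by
      rw [dist_eq_norm, add_sub_cancel_left, norm_smul, A.norm_map, hone, mul_one, Real.norm_eq_abs,
        abs_mul, abs_mul, hσ1, mul_one, abs_of_nonneg ha0, abs_of_nonneg hs0]
    have htri := dist_triangle (x j)
      (x l + (a * ((Real.sqrt 2)⁻¹ * σ)) • A (EuclideanSpace.single m (1 : ℝ))) (x l)
    rw [hpl] at htri
    refine ⟨by linarith, fun hjl => ?_⟩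
    rw [hjl, dist_comm, hpl] at hj
    linarith
  -- Part 1: no pattern site of the witness is assigned to `l`
  have part1 : ∀ v ∈ P', f' v ≠ l := by
    intro v hv hvl
    obtain ⟨-, hfv⟩ := hf' v hv
    rw [hvl] at hfv
    obtain ⟨hdlo, hdhi⟩ := step_matched_dist hP' ha0' A' hv hfv
    -- an octahedron vertex aligned with `x k - x l`
    obtain ⟨m, σ, hσ, hax⟩ := step_exists_axis A (x k - x l)
    obtain ⟨j, hj⟩ := hpo m σ hσ
    obtain ⟨hjl, hjne⟩ := hvert m σ hσ j hj
    have hun : ‖A (EuclideanSpace.single m (1 : ℝ))‖ = 1 := by rw [A.norm_map, hone]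
    have hσsq : σ ^ 2 = 1 := by rcases hσ with rfl | rfl <;> norm_num
    have hwn : ‖x k - x l‖ = dist (x l) (x k) := by rw [dist_comm, dist_eq_norm]
    -- the squared distance from `x k` to that vertex
    have hQ : dist (x k) (x l + (a * ((Real.sqrt 2)⁻¹ * σ)) • A (EuclideanSpace.single m (1 : ℝ))) ^ 2 =
        dist (x l) (x k) ^ 2 - 2 * (a * (Real.sqrt 2)⁻¹) *
          (σ * inner ℝ (A (EuclideanSpace.single m (1 : ℝ))) (x k - x l)) + a ^ 2 / 2 := by
      rw [dist_eq_norm, sub_add_eq_sub_sub, norm_sub_sq_real, real_inner_smul_right,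
        real_inner_comm, norm_smul, hun, mul_one, Real.norm_eq_abs, sq_abs, hwn]
      have : (a * ((Real.sqrt 2)⁻¹ * σ)) ^ 2 = a ^ 2 / 2 := by
        rw [mul_pow, mul_pow, step_inv_sqrt_two_sq, hσsq]; ring
      rw [this]; ring
    have ht : 0.5773 * dist (x l) (x k) ≤
        σ * inner ℝ (A (EuclideanSpace.single m (1 : ℝ))) (x k - x l) := by
      have h3 : (0 : ℝ) < Real.sqrt 3 := by positivity
      have h3' : (Real.sqrt 3)⁻¹ * ‖x k - x l‖ ≤
          σ * inner ℝ (A (EuclideanSpace.single m (1 : ℝ))) (x k - x l) := by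
        rw [inv_mul_le_iff₀ h3]
        exact hax
      rw [hwn] at h3'
      exact le_trans (mul_le_mul_of_nonneg_right hs3 dist_nonneg) h3'
    have hdhi' : dist (x l) (x k) ≤ 1.46422 * a' :=
      hdhi.trans (mul_le_mul_of_nonneg_right (by linarith) ha0')
    have hbound : dist (x k) (x l + (a * ((Real.sqrt 2)⁻¹ * σ)) • A (EuclideanSpace.single m (1 : ℝ))) ^ 2 ≤
        (3 / 2 * a' - a / 20) ^ 2 := by
      rw [hQ]
      exact step_alignment_ineq ha1 ha2 ha1' hdlo hdhi' hs2l ht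
    have hdist : dist (x k) (x l + (a * ((Real.sqrt 2)⁻¹ * σ)) • A (EuclideanSpace.single m (1 : ℝ))) ≤
        3 / 2 * a' - a / 20 := by
      have hpos : 0 ≤ 3 / 2 * a' - a / 20 := by linarith
      exact (pow_le_pow_iff_left₀ dist_nonneg hpos two_ne_zero).1 hbound
    have hjk : dist (x j) (x k) ≤ 3 / 2 * a' := by
      have := dist_triangle (x j)
        (x l + (a * ((Real.sqrt 2)⁻¹ * σ)) • A (EuclideanSpace.single m (1 : ℝ))) (x k)
      rw [dist_comm (x l + _ • _) (x k)] at this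
      linarith
    have hjnek : j ≠ k := by
      intro hjk'
      rw [hjk', dist_comm] at hjl
      linarith
    obtain ⟨v', hv', hfv'⟩ := hcov' j hjnek hjk
    have hvne : v ≠ v' := by
      intro hvv'
      apply hjne
      rw [← hfv', ← hvv', hvl]
    have hfv'' : dist (x j) (x k + a' • A' v') ≤ 1 / 20 * a' := by
      have := (hf' v' hv').2
      rwa [hfv'] at this
    have hsep := step_matched_sep hP' ha0' A' hv hv' hvne hfv hfv''
    -- `dist (x l) (x j) ≥ 9a'/10 ≥ 0.846` against `≤ a/√2 + a/20 ≤ 0.7572`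
    rw [dist_comm] at hjl
    linarith
  refine ⟨part1, ?_⟩
  by_contra hle
  push Not at hle
  by_cases hlk : l = k
  · obtain ⟨j, hj⟩ := hpo 0 1 (Or.inl rfl)
    obtain ⟨hjd, hjl⟩ := hvert 0 1 (Or.inl rfl) j hj
    rw [hlk] at hjd hjl
    have hjd' : dist (x j) (x k) ≤ 3 / 2 * a' := by linarith
    obtain ⟨v, hv, hfv⟩ := hcov' j hjl hjd'
    have h19 := (step_matched_dist hP' ha0' A' hv (hf' v hv).2).1
    rw [hfv] at h19
    linarith
  · obtain ⟨v, hv, hfv⟩ := hcov' l hlk hle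
    exact part1 v hv hfv

end Summit.AtomisticToContinuum.Crystallization.Theorems.PhononSlackCertificatesFarFieldGapR

end
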